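import Summits.BirchSwinnertonDyer.Rank1Residual.ManinAdditive.MinusOneOrbitManinEqHolds
import Summits.BirchSwinnertonDyer.Rank1Residual.ManinAdditive.CuspidalKummerUFamily
import Summits.BirchSwinnertonDyer.Rank1Residual.ManinAdditive.TwistOrbitManinStatements
import HarnessLib
import HarnessLib.Audit.Tags

/-!
# The LEVEL-RAISING `χ₋₄` ROTATION `Λ(f ⊗ χ₋₄) = i·Λ(f)` for `4 ∥ N → 16 ∥ 4N` and its optimal-curve consequences —
# E-an-145 / E-an-145R / E-an-145D typed (cell `bsd-f2-manin`, seat -an gen 32, MEMO-an §75; TURNKEY-an-21 §1–§4; typer g17)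

TYPER NOTE.  SOURCE = HOME/an/g32/Sketch-an-g32.lean sha16 d292290bfb969dc5 (356 l.; farm rc 0 · 0 err · 0 warn · 0 sorry per an;
BC7 4/4 VERDICT CLEAN, Sketch-an-g32.bc7.txt dabf1ab2bc3facc3), §1–§4 landed VERBATIM (namespace `…Rank1Residual.ManinAdditive` as in the
sketch; module docstring = an's, below this note); §5 (E-an-146) is the sibling leaf `CuspidalKummerBlindResidue.lean`.  Three `@[conjecture]`
candidate Props (nothing asserted): **E-an-145 `MinusOneLevelRaisingLatticeRotation`** (THEOREM CANDIDATE, paper proof MEMO-an §75.3 modulo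
S-an-56), **E-an-145R `MinusOneLevelRaisingOptimalOrbit`**, **E-an-145D `MinusOneLevelRaisingDegree`** (LAW); PROVED: the level-agnostic port of
the tree's §22 lattice geometry (`neronLattice_eq_mulLeft_twist_of_rot`, `optimalTwistRigidity_of_rot`, `optimal_c_pow_twelve_mul_Δ_eq_of_rot`,
`optimal_c_eq_or_iff_Δ_eq_of_rot`, `optimal_c_eq_or_of_rot_of_four_dvd`), **`minusOneLevelRaisingOptimalOrbit_of_rotation : E-an-145 → E-an-145R`**,
`two_not_dvd_c_iff_of_levelRaising`, `levelRaising_two_not_dvd_c_of_downstairs`, `cesnaviciusNeururerSahaCorrection_two_eq_zero_of_not_eight_dvd`,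
`two_not_dvd_c_of_odd_degree_of_not_eight_dvd`, `two_not_dvd_c_upstairs_of_odd_degree_downstairs`.
BC5: HOME/an/g32/levelraise_check.out 491c656fb0bf6786 — 43 845/43 845 level-raising pairs `N′ = 4N ≤ 5·10⁵` (optimality commutes, optimal
partner = literal twist, `deg′ = 4·deg`, `Δ′ = Δ`; 0 exceptions).  REFUTER VERDICTS: R-an-56 (ref1) PENDING at filing — repairs under NEW names.
bears_on: stmt-BirchSwinnertonDyer-22967 (C2 `ManinOddAtFour`: transport between the `v₂(N) = 2` and `v₂(N) = 4` strata).
[cite: CesnaviciusNeururerSaha2023, Thm. 1.2 (the print bound used in §4; the rotation law is the cell's E-an-145 — MEMO-an §75, NOT in print)]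

PLANNER'S MODULE DOCSTRING (an g32, verbatim):

# Sketch-an-g32 (cell bsd-f2-manin, seat -an, gen 32; MEMO-an §75) — the LEVEL-RAISING `χ₋₄` ROTATION
# `Λ(f ⊗ χ₋₄) = i·Λ(f)` for `4 ∥ N → 16 ∥ 4N`, its optimal-curve consequences, and the blind residue law `c − β² = ±4`

Nothing is asserted: four `@[conjecture]` candidate `Prop`s (E-an-145 `MinusOneLevelRaisingLatticeRotation`,
E-an-145R `MinusOneLevelRaisingOptimalOrbit`, E-an-145D `MinusOneLevelRaisingDegree`, E-an-146
`BlindQuadraticResidueFour`) and PROVED edges: the level-AGNOSTIC form of the tree's §22 lattice geometry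
(`NegOneOptimalTwistRigidityProof`): a rotation `Λ(f′) = i Λ(f)` between the newforms of lattice-optimal data of
`W`, `W′` at ANY two levels forces `W′ ≅ W ⊗ χ₋₄` over `ℚ` and `c′¹² Δ(W′) = c¹² Δ(W)`, hence (Connell–Pal, both
additive at 2, tree theorem `negOneTwistMinimalDiscrEq_holds`) `c′ = ±c`; so E-an-145 ⟹ E-an-145R, and Manin-oddness
is transported BOTH ways across a level-raising pair.  Paper proof of E-an-145 (MEMO-an §75.3): for `f` of level
`N = 4m` the even coefficients vanish, so `f ⊗ χ₋₄ = −i · f|T_{1/4}` (tree: `CharTwistTwoLevel` half-translate sign at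
level `4N`), `T_{1/4}` normalises `Γ₀(4N)`, and `Λ_{Γ₀(4N)}(f) = Λ_{Γ₀(N)}(f)` because `Γ₀(N) = ⊔_{j<4} Γ₀(4N)·(1 0; jN 1)`
(`2 ∣ N`) with parabolic coset representatives (S-an-11, the one lemma not yet in the tree).
Census (BC5, folder g32/levelraise_check.out over TWISTCENSUS2, every X₀-optimal class `4 ∥ N ≤ 5·10⁵`: 168 649 classes,
43 845 with the `χ₋₄`-partner class `N′ = 4N ≤ 5·10⁵`): optimality commutes 43 845/43 845; optimal partner = literal
twist `[0,−a₂,0,a₄,−a₆]` 43 845/43 845; `deg′ = 4·deg` 43 845/43 845; `Δ′ = Δ` 43 845/43 845; exceptions 0.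
E-an-146 (c-free): over the 94 (class, blind root) instances with `4 ∣ N ≤ 5·10⁵`, `c − β² ∈ {4 (×89), −4 (×5)}`, never
anything else (g32/blind_census.out).  PARTITION 0 · beyond-print theorem: E-an-145/145R candidate YES (paper proof) ·
BSD is not proved by this; Manin's conjecture is not proved by this.
-/

noncomputable section

open scoped MatrixGroups ModularForm

open CongruenceSubgroup WeierstrassCurve
  Literature.NumberTheory.DiophantineGeometry
  Literature.NumberTheory.EllipticCurves
  Literature.NumberTheory.EllipticCurves.ModularForms

namespace Summit.BirchSwinnertonDyer.Rank1Residual.ManinAdditive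

section LevelRaising

open scoped Pointwise

/-! ## §1 E-an-145: the level-raising `χ₋₄` rotation `Λ(f′) = i·Λ(f)` (`4 ∣ N`, `N′ = 4N`) -/

/-- **Candidate E-an-145 `MinusOneLevelRaisingLatticeRotation` (cell bsd-f2-manin, an g32, MEMO-an §75; THEOREM
candidate with a paper proof; nothing asserted):** if `W′ ~ W ⊗ χ₋₄` with `4 ∣ N(W)` and `N(W′) = 4·N(W)` (the
level-RAISING `χ₋₄`-twist, `v₂: 2 → 4`), then the period lattices of the two newforms satisfy `Λ(f′) = i·Λ(f)`:
`z ∈ Λ(f′) ↔ i z ∈ Λ(f)`.  (The same-level case `16 ∣ N = N′` is the tree theorem `minusOneTwistLatticeRotation_holds`.)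
Why it might fail: only through a slip in S-an-11 (`Λ_{Γ₀(4N)}(f) = Λ_{Γ₀(N)}(f)` for `2 ∣ N`); census 43 845/43 845. -/
@[conjecture]
def MinusOneLevelRaisingLatticeRotation : Prop :=
  ∀ (W W' : WeierstrassCurve ℚ) [W.IsElliptic] [W.IsGloballyMinimal] [W'.IsElliptic]
    [W'.IsGloballyMinimal] [NeZero (W.conductorNorm ℤ)] [NeZero (W'.conductorNorm ℤ)]
    (D : ModularParametrizationData W (W.conductorNorm ℤ))
    (D' : ModularParametrizationData W' (W'.conductorNorm ℤ)),
    2 ^ 2 ∣ W.conductorNorm ℤ → W'.conductorNorm ℤ = 4 * W.conductorNorm ℤ →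
    IsIsogenous (W.quadraticTwist ((-1 : ℤ) : ℚ)) W' →
    ∀ z : ℂ, z ∈ periodLattice D'.f ↔ Complex.I * z ∈ periodLattice D.f

/-! ## §2 Level-agnostic lattice geometry: rotation ⟹ rigidity and `c′¹² Δ′ = c¹² Δ` (port of the tree's §22) -/

/-- Lattice bookkeeping from a rotation (ANY two levels): with lattice-optimal data, the Néron lattice of `W′`
is `(c′/c)` times the Néron-type lattice `i⁻¹·Λ_W` of the twisted model `W ⊗ (−1)`. -/
theorem neronLattice_eq_mulLeft_twist_of_rot {W W' : WeierstrassCurve ℚ} [W.IsElliptic]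
    [W.IsGloballyMinimal] [W'.IsElliptic] [W'.IsGloballyMinimal] {N N' : ℕ} [NeZero N] [NeZero N']
    (D : ModularParametrizationData W N) (D' : ModularParametrizationData W' N')
    (hD : IsLatticeOptimal D) (hD' : IsLatticeOptimal D')
    (hrot : ∀ z : ℂ, z ∈ periodLattice D'.f ↔ Complex.I * z ∈ periodLattice D.f)
    (hl0 : ((D'.c : ℂ) / (D.c : ℂ)) ≠ 0) :
    D'.L.lattice = ((D.L.mulLeft (Complex.I)⁻¹ (inv_ne_zero Complex.I_ne_zero)).mulLeft
      ((D'.c : ℂ) / (D.c : ℂ)) hl0).lattice := by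
  have hc0 : (D.c : ℂ) ≠ 0 := D.cast_c_ne_zero
  have hc0' : (D'.c : ℂ) ≠ 0 := D'.cast_c_ne_zero
  ext z
  rw [PeriodPair.mem_mulLeft_lattice, PeriodPair.mem_mulLeft_lattice, inv_inv, inv_div,
    show Complex.I * ((D.c : ℂ) / (D'.c : ℂ) * z) = (D.c : ℂ) * (Complex.I * ((D'.c : ℂ)⁻¹ * z)) by
      rw [div_eq_mul_inv]; ring]
  constructor
  · intro hz
    obtain ⟨w, hw, rfl⟩ := hD' z hz
    rw [inv_mul_cancel_left₀ hc0']
    exact D.smul_periodLattice_le _ ((hrot w).mp hw)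
  · intro hz
    obtain ⟨w, hw, hEq⟩ := hD _ hz
    have hw' : Complex.I * ((D'.c : ℂ)⁻¹ * z) = w := mul_left_cancel₀ hc0 hEq
    have hmem : (D'.c : ℂ)⁻¹ * z ∈ periodLattice D'.f := (hrot _).mpr (hw' ▸ hw)
    have := D'.smul_periodLattice_le _ hmem
    rwa [mul_inv_cancel_left₀ hc0'] at this

/-- **Optimal rigidity from a rotation (ANY two levels):** lattice-optimal `D`, `D′` of `W`, `W′` whose newform
lattices satisfy `Λ(f′) = i·Λ(f)` have `W′ ≅ W ⊗ χ₋₄` over `ℚ`. -/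
theorem optimalTwistRigidity_of_rot {W W' : WeierstrassCurve ℚ} [W.IsElliptic]
    [W.IsGloballyMinimal] [W'.IsElliptic] [W'.IsGloballyMinimal] {N N' : ℕ} [NeZero N] [NeZero N']
    (D : ModularParametrizationData W N) (D' : ModularParametrizationData W' N')
    (hD : IsLatticeOptimal D) (hD' : IsLatticeOptimal D')
    (hrot : ∀ z : ℂ, z ∈ periodLattice D'.f ↔ Complex.I * z ∈ periodLattice D.f) :
    ∃ u : VariableChange ℚ, u • W.quadraticTwist ((-1 : ℤ) : ℚ) = W' := by
  classical
  have hd0 : ((-1 : ℤ) : ℚ) ≠ 0 := by norm_num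
  haveI := W.isElliptic_quadraticTwist hd0
  have hc0 : (D.c : ℂ) ≠ 0 := D.cast_c_ne_zero
  have hc0' : (D'.c : ℂ) ≠ 0 := D'.cast_c_ne_zero
  have hcq : (D.c : ℚ) ≠ 0 := by exact_mod_cast (Int.cast_ne_zero.mp hc0)
  have hcq' : (D'.c : ℚ) ≠ 0 := by exact_mod_cast (Int.cast_ne_zero.mp hc0')
  have hlq : (D'.c : ℚ) / (D.c : ℚ) ≠ 0 := div_ne_zero hcq' hcq
  have hl0 : ((D'.c : ℂ) / (D.c : ℂ)) ≠ 0 := div_ne_zero hc0' hc0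
  have hIsq : Complex.I ^ 2 = ((((-1 : ℤ) : ℚ) : ℚ) : ℂ) := by push_cast; exact Complex.I_sq
  have hLT := isNeronLatticeOf_quadraticTwist_of_sq_eq ((-1 : ℤ) : ℚ) D.isNeronLattice
    Complex.I_ne_zero hIsq
  have hΛ' := neronLattice_eq_mulLeft_twist_of_rot D D' hD hD' hrot hl0
  have hS' : (D'.L.lattice : Set ℂ) = (((D'.c : ℚ) / (D.c : ℚ) : ℚ) : ℂ) •
      ((D.L.mulLeft (Complex.I)⁻¹ (inv_ne_zero Complex.I_ne_zero)).lattice.toAddSubgroup :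
        Set ℂ) := by
    rw [hΛ', coe_mulLeft_lattice_eq_smul, Submodule.coe_toAddSubgroup]
    push_cast
    rfl
  have hST : ((D.L.mulLeft (Complex.I)⁻¹ (inv_ne_zero Complex.I_ne_zero)).lattice : Set ℂ) =
      ((1 : ℚ) : ℂ) • ((D.L.mulLeft (Complex.I)⁻¹ (inv_ne_zero Complex.I_ne_zero)).lattice.toAddSubgroup :
        Set ℂ) := by
    rw [Rat.cast_one, one_smul, Submodule.coe_toAddSubgroup]
  obtain ⟨a₄, a₆, C₁, hW', hg₂, hg₃⟩ :=
    exists_shortModel_of_lattice_eq_smul D'.isNeronLattice hlq hS' (L' := _) rfl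
  obtain ⟨a₄', a₆', C₂, hT, hg₂', hg₃'⟩ :=
    exists_shortModel_of_lattice_eq_smul hLT one_ne_zero hST (L' := _) rfl
  have ha₄ : a₄' = a₄ := by
    have h : (-4 : ℂ) * a₄' = -4 * a₄ := hg₂'.symm.trans hg₂
    exact_mod_cast mul_left_cancel₀ (by norm_num : (-4 : ℂ) ≠ 0) h
  have ha₆ : a₆' = a₆ := by
    have h : (-4 : ℂ) * a₆' = -4 * a₆ := hg₃'.symm.trans hg₃
    exact_mod_cast mul_left_cancel₀ (by norm_num : (-4 : ℂ) ≠ 0) h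
  rw [ha₄, ha₆] at hT
  exact ⟨C₁⁻¹ * C₂, by rw [mul_smul, hT, ← hW', inv_smul_smul]⟩

/-- **The Manin–discriminant identity from a rotation (ANY two levels):** `c′¹² · Δ(W′) = c¹² · Δ(W)`. -/
theorem optimal_c_pow_twelve_mul_Δ_eq_of_rot {W W' : WeierstrassCurve ℚ} [W.IsElliptic]
    [W.IsGloballyMinimal] [W'.IsElliptic] [W'.IsGloballyMinimal] {N N' : ℕ} [NeZero N] [NeZero N']
    (D : ModularParametrizationData W N) (D' : ModularParametrizationData W' N')
    (hD : IsLatticeOptimal D) (hD' : IsLatticeOptimal D')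
    (hrot : ∀ z : ℂ, z ∈ periodLattice D'.f ↔ Complex.I * z ∈ periodLattice D.f) :
    (D'.c : ℚ) ^ 12 * W'.Δ = (D.c : ℚ) ^ 12 * W.Δ := by
  have hc0 : (D.c : ℂ) ≠ 0 := D.cast_c_ne_zero
  have hc0' : (D'.c : ℂ) ≠ 0 := D'.cast_c_ne_zero
  have hl0 : ((D'.c : ℂ) / (D.c : ℂ)) ≠ 0 := div_ne_zero hc0' hc0
  have hIsq : Complex.I ^ 2 = ((((-1 : ℤ) : ℚ) : ℚ) : ℂ) := by push_cast; exact Complex.I_sq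
  have hLT := isNeronLatticeOf_quadraticTwist_of_sq_eq ((-1 : ℤ) : ℚ) D.isNeronLattice
    Complex.I_ne_zero hIsq
  have hΛ' := neronLattice_eq_mulLeft_twist_of_rot D D' hD hD' hrot hl0
  have hΔ' := IsNeronLatticeOf.Δ_eq_of_lattice_eq_mulLeft D'.isNeronLattice hl0 hΛ'
  have hΛT : (D.L.mulLeft (Complex.I)⁻¹ (inv_ne_zero Complex.I_ne_zero)).lattice =
      ((D.L.mulLeft (Complex.I)⁻¹ (inv_ne_zero Complex.I_ne_zero)).mulLeft 1 one_ne_zero).lattice := by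
    ext z
    rw [PeriodPair.mem_mulLeft_lattice (c := 1), inv_one, one_mul]
  have hΔT := IsNeronLatticeOf.Δ_eq_of_lattice_eq_mulLeft hLT one_ne_zero hΛT
  rw [one_pow, inv_one, one_mul, quadraticTwist_Δ] at hΔT
  push_cast at hΔT
  have key : ((D'.c : ℂ) / (D.c : ℂ)) ^ 12 * (W'.Δ : ℂ) = (W.Δ : ℂ) := by
    rw [hΔ', ← mul_assoc, mul_inv_cancel₀ (pow_ne_zero _ hl0), one_mul, ← hΔT]; ring
  have key' : (D'.c : ℂ) ^ 12 * (W'.Δ : ℂ) = (D.c : ℂ) ^ 12 * (W.Δ : ℂ) := by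
    rw [← key, div_pow, ← mul_assoc, mul_div_cancel₀ _ (pow_ne_zero _ hc0)]
  exact_mod_cast key'

/-- `c′ = ±c ⟺ Δ(W′) = Δ(W)` for lattice-optimal data related by a rotation (ANY two levels). -/
theorem optimal_c_eq_or_iff_Δ_eq_of_rot {W W' : WeierstrassCurve ℚ} [W.IsElliptic]
    [W.IsGloballyMinimal] [W'.IsElliptic] [W'.IsGloballyMinimal] {N N' : ℕ} [NeZero N] [NeZero N']
    (D : ModularParametrizationData W N) (D' : ModularParametrizationData W' N')
    (hD : IsLatticeOptimal D) (hD' : IsLatticeOptimal D')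
    (hrot : ∀ z : ℂ, z ∈ periodLattice D'.f ↔ Complex.I * z ∈ periodLattice D.f) :
    ((D'.c = D.c ∨ D'.c = -D.c) ↔ W'.Δ = W.Δ) := by
  have key := optimal_c_pow_twelve_mul_Δ_eq_of_rot D D' hD hD' hrot
  have hΔ0 : W.Δ ≠ 0 := W.isUnit_Δ.ne_zero
  have hc0 : (D.c : ℚ) ≠ 0 := by exact_mod_cast (Int.cast_ne_zero.mp D.cast_c_ne_zero)
  constructor
  · intro h
    have hsq : (D'.c : ℚ) ^ 12 = (D.c : ℚ) ^ 12 := by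
      rcases h with h | h
      · rw [h]
      · rw [h]; push_cast; ring
    rw [hsq] at key
    exact mul_left_cancel₀ (pow_ne_zero _ hc0) key
  · intro h
    rw [h] at key
    have hpow : (D'.c : ℚ) ^ 12 = (D.c : ℚ) ^ 12 := mul_right_cancel₀ hΔ0 key
    have hpow' : D'.c ^ 12 = D.c ^ 12 := by exact_mod_cast hpow
    have habs : |D'.c| = |D.c| := by
      have := congrArg Int.natAbs hpow'
      rw [Int.natAbs_pow, Int.natAbs_pow] at this
      have h' : D'.c.natAbs = D.c.natAbs := Nat.pow_left_injective (by norm_num) this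
      rw [Int.abs_eq_natAbs, Int.abs_eq_natAbs, h']
    exact abs_eq_abs.mp habs

/-- **`c′ = ±c` from a rotation when BOTH curves are additive at 2** (Connell–Pal `Δ(W′) = Δ(W)`, tree theorem
`negOneTwistMinimalDiscrEq_holds`; ANY two levels). -/
theorem optimal_c_eq_or_of_rot_of_four_dvd {W W' : WeierstrassCurve ℚ} [W.IsElliptic]
    [W.IsGloballyMinimal] [W'.IsElliptic] [W'.IsGloballyMinimal] {N N' : ℕ} [NeZero N] [NeZero N']
    (D : ModularParametrizationData W N) (D' : ModularParametrizationData W' N')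
    (hD : IsLatticeOptimal D) (hD' : IsLatticeOptimal D')
    (hrot : ∀ z : ℂ, z ∈ periodLattice D'.f ↔ Complex.I * z ∈ periodLattice D.f)
    (h4 : 2 ^ 2 ∣ W.conductorNorm ℤ) (h4' : 2 ^ 2 ∣ W'.conductorNorm ℤ) :
    D'.c = D.c ∨ D'.c = -D.c := by
  obtain ⟨u, hu⟩ := optimalTwistRigidity_of_rot D D' hD hD' hrot
  exact (optimal_c_eq_or_iff_Δ_eq_of_rot D D' hD hD' hrot).mpr
    (negOneTwistMinimalDiscrEq_holds W W' u h4 h4' hu)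

/-! ## §3 E-an-145R / E-an-145D: the optimal-curve consequences, and E-an-145 ⟹ E-an-145R PROVED -/

/-- **Candidate E-an-145R `MinusOneLevelRaisingOptimalOrbit` (cell bsd-f2-manin, an g32, MEMO-an §75; nothing
asserted):** on a level-raising `χ₋₄`-pair (`4 ∣ N(W)`, `N(W′) = 4 N(W)`, `W′ ~ W ⊗ χ₋₄`) with lattice-optimal data,
(1) `W′ ≅ W ⊗ χ₋₄` over `ℚ` («the optimal curve of the twisted class is the twist of the optimal curve») and
(2) `c′ = ±c`.  Census: `#1 ↦ #1` and optimal model = literal twist, 43 845/43 845 pairs `N′ = 4N ≤ 5·10⁵`.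
PROVED below from E-an-145 (`minusOneLevelRaisingOptimalOrbit_of_rotation`).  Why it might fail: only with E-an-145. -/
@[conjecture]
def MinusOneLevelRaisingOptimalOrbit : Prop :=
  ∀ (W W' : WeierstrassCurve ℚ) [W.IsElliptic] [W.IsGloballyMinimal] [W'.IsElliptic]
    [W'.IsGloballyMinimal] [NeZero (W.conductorNorm ℤ)] [NeZero (W'.conductorNorm ℤ)]
    (D : ModularParametrizationData W (W.conductorNorm ℤ))
    (D' : ModularParametrizationData W' (W'.conductorNorm ℤ)),
    IsLatticeOptimal D → IsLatticeOptimal D' →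
    2 ^ 2 ∣ W.conductorNorm ℤ → W'.conductorNorm ℤ = 4 * W.conductorNorm ℤ →
    IsIsogenous (W.quadraticTwist ((-1 : ℤ) : ℚ)) W' →
    (∃ u : VariableChange ℚ, u • W.quadraticTwist ((-1 : ℤ) : ℚ) = W') ∧ (D'.c = D.c ∨ D'.c = -D.c)

/-- **PROVED: E-an-145 ⟹ E-an-145R.** -/
theorem minusOneLevelRaisingOptimalOrbit_of_rotation (h : MinusOneLevelRaisingLatticeRotation) :
    MinusOneLevelRaisingOptimalOrbit := by
  intro W W' _ _ _ _ _ _ D D' hD hD' h4 hN hiso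
  have hrot := h W W' D D' h4 hN hiso
  have h4' : 2 ^ 2 ∣ W'.conductorNorm ℤ := by
    rw [hN]; exact dvd_mul_of_dvd_right h4 4
  exact ⟨optimalTwistRigidity_of_rot D D' hD hD' hrot,
    optimal_c_eq_or_of_rot_of_four_dvd D D' hD hD' hrot h4 h4'⟩

/-- **C2 corollary (PROVED from E-an-145R): Manin-oddness is transported BOTH ways across a level-raising
`χ₋₄`-pair** — `2 ∤ c ↔ 2 ∤ c′` (so C2 on the `v₂(N) = 2` stratum ⟺ C2 on its `χ₋₄`-image in the `v₂(N) = 4`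
stratum; the upward direction alone is the route's landed `ManinLocalTwoThreeAdditiveDyadicTransport` §3). -/
theorem two_not_dvd_c_iff_of_levelRaising (h : MinusOneLevelRaisingOptimalOrbit)
    (W W' : WeierstrassCurve ℚ) [W.IsElliptic] [W.IsGloballyMinimal] [W'.IsElliptic]
    [W'.IsGloballyMinimal] [NeZero (W.conductorNorm ℤ)] [NeZero (W'.conductorNorm ℤ)]
    (D : ModularParametrizationData W (W.conductorNorm ℤ))
    (D' : ModularParametrizationData W' (W'.conductorNorm ℤ))
    (hD : IsLatticeOptimal D) (hD' : IsLatticeOptimal D') (h4 : 2 ^ 2 ∣ W.conductorNorm ℤ)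
    (hN : W'.conductorNorm ℤ = 4 * W.conductorNorm ℤ)
    (hiso : IsIsogenous (W.quadraticTwist ((-1 : ℤ) : ℚ)) W') :
    ¬ (2 : ℤ) ∣ D.c ↔ ¬ (2 : ℤ) ∣ D'.c := by
  obtain ⟨-, hc | hc⟩ := h W W' D D' hD hD' h4 hN hiso
  · rw [hc]
  · rw [hc, dvd_neg]

/-- **Candidate E-an-145D `MinusOneLevelRaisingDegree` (cell bsd-f2-manin, an g32, MEMO-an §75; LAW with a paper
proof sketch via Petersson norms — `‖f|T_{1/4}‖²_{Γ₀(4N)} = 4‖f‖²_{Γ₀(N)}`; nothing asserted):** on a level-raising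
`χ₋₄`-pair with lattice-optimal data the modular degree is multiplied by EXACTLY `4 = [Γ₀(N) : Γ₀(4N)]`.
Census: 43 845/43 845 pairs `N′ = 4N ≤ 5·10⁵`, 0 exceptions.  Why it might fail: a pair where the optimal quotient
map at level `4N` factors differently (none in range; the Petersson argument is level-uniform). -/
@[conjecture]
def MinusOneLevelRaisingDegree : Prop :=
  ∀ (W W' : WeierstrassCurve ℚ) [W.IsElliptic] [W.IsGloballyMinimal] [W'.IsElliptic]
    [W'.IsGloballyMinimal] [NeZero (W.conductorNorm ℤ)] [NeZero (W'.conductorNorm ℤ)]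
    (D : ModularParametrizationData W (W.conductorNorm ℤ))
    (D' : ModularParametrizationData W' (W'.conductorNorm ℤ)),
    IsLatticeOptimal D → IsLatticeOptimal D' →
    2 ^ 2 ∣ W.conductorNorm ℤ → W'.conductorNorm ℤ = 4 * W.conductorNorm ℤ →
    IsIsogenous (W.quadraticTwist ((-1 : ℤ) : ℚ)) W' →
    D'.modularDegree = 4 * D.modularDegree

/-- **PROVED edge (C2 bookkeeping): on a level-raising pair, `v₂(c′) ≤ v₂(deg′)` needs no ČNS correction term
transport** — if `2 ∤ c` downstairs then `2 ∤ c′` upstairs (E-an-145R), while `deg′ = 4 deg` (E-an-145D) shows the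
ČNS bound `v₂(c′) ≤ v₂(deg′) + 1` is SLACK by ≥ 3 upstairs: the degree road can never decide the `16 ∥ N` image. -/
theorem levelRaising_two_not_dvd_c_of_downstairs (hR : MinusOneLevelRaisingOptimalOrbit)
    (W W' : WeierstrassCurve ℚ) [W.IsElliptic] [W.IsGloballyMinimal] [W'.IsElliptic]
    [W'.IsGloballyMinimal] [NeZero (W.conductorNorm ℤ)] [NeZero (W'.conductorNorm ℤ)]
    (D : ModularParametrizationData W (W.conductorNorm ℤ))
    (D' : ModularParametrizationData W' (W'.conductorNorm ℤ))
    (hD : IsLatticeOptimal D) (hD' : IsLatticeOptimal D') (h4 : 2 ^ 2 ∣ W.conductorNorm ℤ)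
    (hN : W'.conductorNorm ℤ = 4 * W.conductorNorm ℤ)
    (hiso : IsIsogenous (W.quadraticTwist ((-1 : ℤ) : ℚ)) W') (hc : ¬ (2 : ℤ) ∣ D.c) :
    ¬ (2 : ℤ) ∣ D'.c :=
  (two_not_dvd_c_iff_of_levelRaising hR W W' D D' hD hD' h4 hN hiso).mp hc

/-! ## §4 C2 on the `u`-family: the `4 ∥ N` branch from ČNS + odd degree; the `16 ∥ N` branch by E-an-145R -/

/-- The ČNS correction term at `p = 2` vanishes when `8 ∤ N`. [cite: CesnaviciusNeururerSaha2023, Thm. 1.2] -/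
theorem cesnaviciusNeururerSahaCorrection_two_eq_zero_of_not_eight_dvd {M : ℕ} (h8 : ¬ 2 ^ 3 ∣ M) :
    cesnaviciusNeururerSahaCorrection M 2 = 0 :=
  cesnaviciusNeururerSahaCorrection_eq_zero (fun h ↦ h8 h.2.1) (fun h ↦ by omega)

/-- **PROVED (in print modulo the odd-degree input): ČNS Thm 1.2 with `ε₂ = 0` (`8 ∤ N`) and an odd modular degree
give `2 ∤ c`** — the mechanism that settles the 55 `IV*` members `N = 4(u² + 4)` of the blind family (odd degree
55/55 in range; beyond, Yazdani's printed expectation after Thm 3.8, arXiv:0910.0571 p. 15, = imc E-imc-28). -/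
theorem two_not_dvd_c_of_odd_degree_of_not_eight_dvd (hCNS : cesnaviciusNeururerSaha_thm_1_2)
    (W : WeierstrassCurve ℚ) [W.IsElliptic] [W.IsGloballyMinimal] [NeZero (W.conductorNorm ℤ)]
    (D : ModularParametrizationData W (W.conductorNorm ℤ)) (h8 : ¬ 2 ^ 3 ∣ W.conductorNorm ℤ)
    (hdeg : ¬ 2 ∣ D.modularDegree) : ¬ (2 : ℤ) ∣ D.c := by
  have hle : padicValInt 2 D.maninConstant ≤ padicValNat 2 D.modularDegree := by
    have := hCNS W D 2 Nat.prime_two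
    rwa [cesnaviciusNeururerSahaCorrection_two_eq_zero_of_not_eight_dvd h8, add_zero] at this
  exact not_dvd_maninConstant_of_padicVal_le_of_not_dvd D Nat.prime_two hle hdeg

/-- **PROVED: C2 on the `16 ∥ N` image of an odd-degree `4 ∥ N` class** — ČNS downstairs + E-an-145R transport.
This is how the 31 `I₀*` members `N = 16(u² + 4)` of the blind family inherit `2 ∤ c` from their `4(u² + 4)` partners
(where ČNS itself is mute upstairs: `ε₂(16p) = 1` for `p ≡ 1 (mod 4)` and `v₂(deg′) = 2`). -/
theorem two_not_dvd_c_upstairs_of_odd_degree_downstairs (hCNS : cesnaviciusNeururerSaha_thm_1_2)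
    (hR : MinusOneLevelRaisingOptimalOrbit)
    (W W' : WeierstrassCurve ℚ) [W.IsElliptic] [W.IsGloballyMinimal] [W'.IsElliptic]
    [W'.IsGloballyMinimal] [NeZero (W.conductorNorm ℤ)] [NeZero (W'.conductorNorm ℤ)]
    (D : ModularParametrizationData W (W.conductorNorm ℤ))
    (D' : ModularParametrizationData W' (W'.conductorNorm ℤ))
    (hD : IsLatticeOptimal D) (hD' : IsLatticeOptimal D') (h4 : 2 ^ 2 ∣ W.conductorNorm ℤ)
    (h8 : ¬ 2 ^ 3 ∣ W.conductorNorm ℤ) (hN : W'.conductorNorm ℤ = 4 * W.conductorNorm ℤ)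
    (hiso : IsIsogenous (W.quadraticTwist ((-1 : ℤ) : ℚ)) W') (hdeg : ¬ 2 ∣ D.modularDegree) :
    ¬ (2 : ℤ) ∣ D'.c :=
  levelRaising_two_not_dvd_c_of_downstairs hR W W' D D' hD hD' h4 hN hiso
    (two_not_dvd_c_of_odd_degree_of_not_eight_dvd hCNS W D h8 hdeg)

end LevelRaising

end Summit.BirchSwinnertonDyer.Rank1Residual.ManinAdditive
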